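import Summits.QuantumFields.YangMills.Theorems.InfiniteVolumePerOrderCentreBase
import HarnessLib

/-!
# Infinite volume by compactness, STATE-LEVEL engine: centre versus base evaluation points for GIVEN states

Support file for `DyadicChessboard.DyadicCalibration` (stmt-QuantumFields-23371).  Verbatim re-run of the landed
`InfiniteVolume.PerOrderLarge.{tendsto_tsum_shift_sub_base, tendsto_centre_sub_base_zero, tendsto_base_of_tendsto_centre}`
with the per-order collar bound ASSUMED ON THE GIVEN STATES `μ_k ∈ oddTorusLimitPoints r β_k` (`ℤ⁴`-separation form) instead
of inherited from odd-torus ceilings; the shift-defect estimate `norm_tsum_weight_shift_sub_le_of_zdCollar` is cited BY NAME.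
All thresholds are assumed at every index (the consumer works along an admissible sequence), so no index shift is needed.

HONEST FRAMING: soft analysis; the state collar bound is a HYPOTHESIS; no statement about Bałaban's renormalisation group,
reflection positivity, chessboard estimates, a mass gap or Clay; no summit is proved (rung R2a plumbing).  Width seat
ym-line-sfw-p2-w2 g23.

References: Glimm–Jaffe (1987) §6.1; Osterwalder–Schrader CMP 42 (1975) §2; Chatterjee arXiv:1803.01950 §2.
-/

set_option autoImplicit false

noncomputable section

open scoped BigOperators SchwartzMap
open MeasureTheory Filter Topology
open Literature.MathematicalPhysics.QuantumFieldTheory hiding ZdEdge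
open Literature.MathematicalPhysics.QuantumLattice
open Literature.MathematicalPhysics.AQFT
open Literature.Probability.LatticeModels (box Site)
open Summit.QuantumFields.YangMills.Cruxes.OSLegsFromFemtoAndGap.DlrCollarTransfer (plane)

namespace Summit.QuantumFields.YangMills.Theorems.InfiniteVolume.PerOrderState

variable {G : Type} [Group G] [TopologicalSpace G] [IsTopologicalGroup G] [CompactSpace G]
  [MeasurableSpace G] [BorelSpace G]

/-- **The shift defect tends to zero along an admissible sequence, GIVEN states, per-order constants** (verbatim
`PerOrderLarge.tendsto_tsum_shift_sub_base` with the collar bound assumed on the states). [folklore] -/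
theorem tendsto_tsum_shift_sub_base (r : LatticeRep G) {a : ℝ → ℝ} (Cn : ℕ → ℝ) {ℓ₄ : ℝ} (hℓ : 0 < ℓ₄)
    (hC : ∀ n, 0 ≤ Cn n)
    {Cp : ℝ} (hCp : ∀ (q : Fin 4 × Fin 4) (x : Fin 4 → ℤ) (U : LGConfig 4 G), |plane G r q x U| ≤ Cp)
    (β : ℕ → ℝ) (ha : ∀ k, 0 < a (β k)) (ha24 : ∀ k, a (β k) ≤ 1 / 24)
    (haℓ : ∀ k, a (β k) ≤ ℓ₄) (ha0 : Tendsto (fun k => a (β k)) atTop (𝓝 0))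
    (μ : ℕ → Measure (LGConfig 4 G)) (hμ : ∀ k, μ k ∈ oddTorusLimitPoints r (β k))
    (HW : ∀ (k n : ℕ) (q : Fin n → Fin 4 × Fin 4), (∀ i, (q i).1 < (q i).2) →
      ∀ (x : Fin n → Site 4) (R : ℕ), 1 ≤ R → (R : ℝ) * a (β k) ≤ ℓ₄ →
        (∀ i j : Fin n, i ≠ j → ∃ m : Fin 4, (2 * (R : ℤ) + 4) ≤ |x i m - x j m|) →
        |∫ U, ∏ i, (plane G r (q i) (x i) U - ∫ V, plane G r (q i) (x i) V ∂(μ k)) ∂(μ k)| ≤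
          (Cn n / (R : ℝ) ^ 4) ^ n)
    {n : ℕ} (hn : 2 ≤ n) (q : Fin n → Fin 4 × Fin 4) (hq : ∀ i, (q i).1 < (q i).2)
    (c : ℕ → Fin n → EuclideanSpace ℝ (Fin 4)) (hc : ∀ k l, ‖c k l‖ ≤ a (β k))
    (F : 𝓢((Fin n → EuclideanSpace ℝ (Fin 4)), ℂ)) (hF : IsOffDiagonal F) :
    Tendsto (fun k => ∑' x : Fin n → Site 4,
        (((∫ U, ∏ i, (plane G r (q i) (x i) U - ∫ V, plane G r (q i) (x i) V ∂(μ k)) ∂(μ k) : ℝ) : ℂ)) *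
          F (fun l => a (β k) • siteToE (x l) + c k l) -
      ∑' x : Fin n → Site 4,
        (((∫ U, ∏ i, (plane G r (q i) (x i) U - ∫ V, plane G r (q i) (x i) V ∂(μ k)) ∂(μ k) : ℝ) : ℂ)) *
          F (fun l => a (β k) • siteToE (x l))) atTop (𝓝 0) := by
  have hCp0 : 0 ≤ Cp := le_trans (abs_nonneg _) (hCp (0, 1) 0 (fun _ => 1))
  haveI : ∀ k, IsProbabilityMeasure (μ k) := fun k => by
    obtain ⟨S', -, hlim⟩ := hμ k
    exact hlim.1
  have ha1 : ∀ k, a (β k) ≤ 1 := fun k => (ha24 k).trans (by norm_num)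
  set KK : ℝ := (((Cp + Cp) * 4 ^ 4 * 5 ^ 6 + (Cp + Cp) * 2 ^ 6 * (10 + 2 * (0 + 1)) ^ 4 +
      16 * Cn n * 2 ^ 6 * (2 / ℓ₄ + 48) ^ 4) * 2 ^ 6 * (81 * ∑' m : ℕ, (((m : ℝ) + 1) ^ 2)⁻¹)) ^ n with hKK
  have hKK0 : 0 ≤ KK := by
    have : 0 ≤ ∑' m : ℕ, (((m : ℝ) + 1) ^ 2)⁻¹ := tsum_nonneg fun m => by positivity
    have := hC n
    positivity
  -- the shift defect at level `k` is at most `2 ‖c k‖ KK (5 ‖F‖)`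
  have hdef : ∀ k, ‖∑' x : Fin n → Site 4,
        (((∫ U, ∏ i, (plane G r (q i) (x i) U - ∫ V, plane G r (q i) (x i) V ∂(μ k)) ∂(μ k) : ℝ) : ℂ)) *
          F (fun l => a (β k) • siteToE (x l) + c k l) -
      ∑' x : Fin n → Site 4,
        (((∫ U, ∏ i, (plane G r (q i) (x i) U - ∫ V, plane G r (q i) (x i) V ∂(μ k)) ∂(μ k) : ℝ) : ℂ)) *
          F (fun l => a (β k) • siteToE (x l))‖ ≤ 2 * ‖c k‖ * KK * (5 * schwartzNorm (10 * n + 1) F) := by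
    intro k
    have h := norm_tsum_weight_shift_sub_le_of_zdCollar (s₁ := 0) (s₂ := 1) hℓ (hC n)
      (by positivity : 0 ≤ Cp + Cp)
      (fun x => ∫ U, ∏ i, (plane G r (q i) (x i) U - ∫ V, plane G r (q i) (x i) V ∂(μ k)) ∂(μ k))
      (fun x => abs_infVolWeight_le r hCp (μ k) q x)
      (fun x R hR hRa hsep => HW k n q hq x R hR hRa hsep)
      (ha k) (ha1 k) (haℓ k) hn le_rfl zero_le_one (by norm_num) (by linarith [ha24 k]) F hF
      (fun x l => a (β k) • siteToE (x l)) (fun x l => by simp) (c k) (fun l => by rw [one_mul]; exact hc k l)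
    have heq : ∀ x : Fin n → Site 4, ((fun l => a (β k) • siteToE (x l)) + c k) =
        fun l => a (β k) • siteToE (x l) + c k l := fun x => by
      funext l; simp only [Pi.add_apply]
    simp only [heq] at h
    exact h
  -- `‖c k‖ ≤ a (β k) → 0`
  have hck : ∀ k, ‖c k‖ ≤ a (β k) := fun k => by
    refine (pi_norm_le_iff_of_nonneg (ha k).le).2 fun l => hc k l
  rw [NormedAddGroup.tendsto_nhds_zero]
  intro ε hε
  have hlim : Tendsto (fun k => 2 * a (β k) * KK * (5 * schwartzNorm (10 * n + 1) F)) atTop (𝓝 0) := by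
    have := ((ha0.const_mul 2).mul_const KK).mul_const (5 * schwartzNorm (10 * n + 1) F)
    simpa using this
  filter_upwards [(NormedAddGroup.tendsto_nhds_zero.1 hlim) ε hε] with k hk
  have hnn : 0 ≤ 2 * a (β k) * KK * (5 * schwartzNorm (10 * n + 1) F) := by
    have := schwartzNorm_nonneg (10 * n + 1) F
    have := (ha k).le
    positivity
  rw [Real.norm_of_nonneg hnn] at hk
  calc _ ≤ 2 * ‖c k‖ * KK * (5 * schwartzNorm (10 * n + 1) F) := hdef k
    _ ≤ 2 * a (β k) * KK * (5 * schwartzNorm (10 * n + 1) F) := by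
        have := schwartzNorm_nonneg (10 * n + 1) F
        gcongr
        exact hck k
    _ < ε := hk

/-- **Centre minus base `→ 0` along an admissible sequence, GIVEN states, per-order constants** (verbatim
`PerOrderLarge.tendsto_centre_sub_base_zero`, all thresholds assumed at every index). [folklore] -/
theorem tendsto_centre_sub_base_zero (r : LatticeRep G) {a : ℝ → ℝ} (Cn : ℕ → ℝ) {ℓ₄ : ℝ} (hℓ : 0 < ℓ₄)
    (hC : ∀ n, 0 ≤ Cn n)
    {Cp : ℝ} (hCp : ∀ (q : Fin 4 × Fin 4) (x : Fin 4 → ℤ) (U : LGConfig 4 G), |plane G r q x U| ≤ Cp)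
    (β : ℕ → ℝ) (ha : ∀ k, 0 < a (β k)) (ha24 : ∀ k, a (β k) ≤ 1 / 24)
    (haℓ : ∀ k, a (β k) ≤ ℓ₄) (ha0 : Tendsto (fun k => a (β k)) atTop (𝓝 0))
    (μ : ℕ → Measure (LGConfig 4 G)) (hμ : ∀ k, μ k ∈ oddTorusLimitPoints r (β k))
    (HW : ∀ (k n : ℕ) (q : Fin n → Fin 4 × Fin 4), (∀ i, (q i).1 < (q i).2) →
      ∀ (x : Fin n → Site 4) (R : ℕ), 1 ≤ R → (R : ℝ) * a (β k) ≤ ℓ₄ →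
        (∀ i j : Fin n, i ≠ j → ∃ m : Fin 4, (2 * (R : ℤ) + 4) ≤ |x i m - x j m|) →
        |∫ U, ∏ i, (plane G r (q i) (x i) U - ∫ V, plane G r (q i) (x i) V ∂(μ k)) ∂(μ k)| ≤
          (Cn n / (R : ℝ) ^ 4) ^ n)
    {n : ℕ} (hn : 2 ≤ n) (q : Fin n → Fin 4 × Fin 4) (hq : ∀ i, (q i).1 < (q i).2)
    (F : 𝓢((Fin n → EuclideanSpace ℝ (Fin 4)), ℂ)) (hF : IsOffDiagonal F) :
    Tendsto (fun k => ∑' x : Fin n → (Fin 4 → ℤ), ((stateMomentStr G r (μ k) n q x : ℝ) : ℂ) *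
        F (fun l => a (β k) • siteToE (x l) +
          (a (β k) / 2) • (EuclideanSpace.single (q l).1 (1 : ℝ) + EuclideanSpace.single (q l).2 (1 : ℝ))) -
      ∑' x : Fin n → (Fin 4 → ℤ), ((stateMomentStr G r (μ k) n q x : ℝ) : ℂ) * F (fun l => a (β k) • siteToE (x l)))
      atTop (𝓝 0) := by
  have hc : ∀ (k : ℕ) (l : Fin n), ‖(a (β k) / 2) •
      (EuclideanSpace.single (q l).1 (1 : ℝ) + EuclideanSpace.single (q l).2 (1 : ℝ))‖ ≤ a (β k) :=
    fun k l => by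
      rw [norm_smul, Real.norm_of_nonneg (by linarith [(ha k).le] : (0 : ℝ) ≤ a (β k) / 2)]
      have h1 : ‖EuclideanSpace.single (q l).1 (1 : ℝ) + EuclideanSpace.single (q l).2 (1 : ℝ)‖ ≤ 2 := by
        have e1 : ‖EuclideanSpace.single (q l).1 (1 : ℝ)‖ = 1 := by
          rw [show EuclideanSpace.single (q l).1 (1 : ℝ) = PiLp.single 2 (q l).1 (1 : ℝ) from rfl,
            PiLp.norm_single 2 (fun _ : Fin 4 => ℝ) (q l).1 (1 : ℝ), norm_one]
        have e2 : ‖EuclideanSpace.single (q l).2 (1 : ℝ)‖ = 1 := by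
          rw [show EuclideanSpace.single (q l).2 (1 : ℝ) = PiLp.single 2 (q l).2 (1 : ℝ) from rfl,
            PiLp.norm_single 2 (fun _ : Fin 4 => ℝ) (q l).2 (1 : ℝ), norm_one]
        calc _ ≤ ‖EuclideanSpace.single (q l).1 (1 : ℝ)‖ + ‖EuclideanSpace.single (q l).2 (1 : ℝ)‖ :=
              norm_add_le _ _
          _ = 2 := by rw [e1, e2]; norm_num
      nlinarith [(ha k).le]
  exact tendsto_tsum_shift_sub_base r Cn hℓ hC hCp β ha ha24 haℓ ha0 μ hμ HW hn q hq
    (fun k l => (a (β k) / 2) • (EuclideanSpace.single (q l).1 (1 : ℝ) + EuclideanSpace.single (q l).2 (1 : ℝ)))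
    hc F hF

/-- **Base-point convergence from centre convergence, GIVEN states, per-order constants** (verbatim
`PerOrderLarge.tendsto_base_of_tendsto_centre`). [folklore] -/
theorem tendsto_base_of_tendsto_centre (r : LatticeRep G) {a : ℝ → ℝ} (Cn : ℕ → ℝ) {ℓ₄ : ℝ} (hℓ : 0 < ℓ₄)
    (hC : ∀ n, 0 ≤ Cn n)
    {Cp : ℝ} (hCp : ∀ (q : Fin 4 × Fin 4) (x : Fin 4 → ℤ) (U : LGConfig 4 G), |plane G r q x U| ≤ Cp)
    (β : ℕ → ℝ) (ha : ∀ k, 0 < a (β k)) (ha24 : ∀ k, a (β k) ≤ 1 / 24)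
    (haℓ : ∀ k, a (β k) ≤ ℓ₄) (ha0 : Tendsto (fun k => a (β k)) atTop (𝓝 0))
    (μ : ℕ → Measure (LGConfig 4 G)) (hμ : ∀ k, μ k ∈ oddTorusLimitPoints r (β k))
    (HW : ∀ (k n : ℕ) (q : Fin n → Fin 4 × Fin 4), (∀ i, (q i).1 < (q i).2) →
      ∀ (x : Fin n → Site 4) (R : ℕ), 1 ≤ R → (R : ℝ) * a (β k) ≤ ℓ₄ →
        (∀ i j : Fin n, i ≠ j → ∃ m : Fin 4, (2 * (R : ℤ) + 4) ≤ |x i m - x j m|) →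
        |∫ U, ∏ i, (plane G r (q i) (x i) U - ∫ V, plane G r (q i) (x i) V ∂(μ k)) ∂(μ k)| ≤
          (Cn n / (R : ℝ) ^ 4) ^ n)
    {n : ℕ} (hn : 2 ≤ n) (q : Fin n → Fin 4 × Fin 4) (hq : ∀ i, (q i).1 < (q i).2)
    (F : 𝓢((Fin n → EuclideanSpace ℝ (Fin 4)), ℂ)) (hF : IsOffDiagonal F) {z : ℂ}
    (h : Tendsto (fun k => ∑' x : Fin n → (Fin 4 → ℤ), ((stateMomentStr G r (μ k) n q x : ℝ) : ℂ) *
        F (fun l => a (β k) • siteToE (x l) +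
          (a (β k) / 2) • (EuclideanSpace.single (q l).1 (1 : ℝ) + EuclideanSpace.single (q l).2 (1 : ℝ))))
        atTop (𝓝 z)) :
    Tendsto (fun k => ∑' x : Fin n → (Fin 4 → ℤ), ((stateMomentStr G r (μ k) n q x : ℝ) : ℂ) *
        F (fun l => a (β k) • siteToE (x l))) atTop (𝓝 z) := by
  have hd := tendsto_centre_sub_base_zero r Cn hℓ hC hCp β ha ha24 haℓ ha0 μ hμ HW hn q hq F hF
  have h2 := h.sub hd
  rw [sub_zero] at h2
  refine h2.congr fun k => ?_
  simp only [sub_sub_cancel]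

end Summit.QuantumFields.YangMills.Theorems.InfiniteVolume.PerOrderState

end
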